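import Summits.QuantumFields.BalabanUV.T4Continuum.Support.RegionGaugeSlice

/-!
# `BalabanUV.T4Continuum.Support.RegionGaugeSliceOrth` — NE2 (node U1a) formalisation swarm, SUPPLIER item «Δ1-COERC-ORTH» under the
# owner's sub-row `T4-U1a.S-NE2-D1-DIRICHLET°` (vector layer, W1): BAŁABAN's SLICE `{R(Ω₀)·∂*A = 0}` REDUCED TO THE ORTHOGONAL SLICE
# `{A ⊥ ∂N(Q′)}` = «the region divergence of `A` is block-constant» — the displayed inequality `SliceCoercive` of leaf-07-g5's
# `RegionGaugeSlice` is EQUIVALENT (up to an explicit factor) to coercivity of the gauge-invariant form on the ℓ²-orthogonal complement of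
# the residual gauge directions, for ABSTRACT data (unit b2b-balaban-t4-ne2-formalise-leaf-09, gen 8, v1)

HONEST FRAMING (T4-DAG p. 1).  [folklore] finite-dimensional linear algebra on the abstract data of `RegionGaugeSlice` (`C`, `D`, `Δ′`,
`G′`, `Q′`, `Q`, `D₁`); a REDUCTION — the slice inequality itself (memo `t4/T4-EST-NE2-D1-COERC.md` §6) stays OPEN; nothing printed is a
hypothesis; NE2 (U1a) NOT proved; spine PROVED 0/9 unchanged; NOT [B9] (3.23)–(3.27) as printed; NOT infinite volume, NOT the mass gap, NOT
Clay.  HONEST DEPENDENCY (verbatim): «continuum YM on T⁴ ⇐ BetaPertH ∧ nine spine estimates (0/9 proved); BetaPertH ⇐ (D1) ∧ (D4) ∧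
CAP+tail; G-an2-4 gates asym, D1 and NE2/3/4.»

WHY.  Leaf-07-g5 reduced the bound `‖G(Ω₀)‖ ≤ max(2/c, 2γ′⁻¹)` for the [B9]-faithful `U = 1` region vector operator (3.26)–(3.27) to ONE
displayed inequality `SliceCoercive C D G′ Q′ Q a c`: `c‖A′‖² ≤ ‖CA′‖² + a‖QA′‖²` on Bałaban's slice `R·DᴴA′ = 0`, `R = gaugeR G′ Q′`
the projection (3.25) onto `Δ′N(Q′)` — a hypothesis that still carries the region's Green's function `G′(Ω₀)` and the non-local
projection `R(Ω₀)`.  THIS FILE removes both from the hypothesis: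

 * §1 [shape] **`OrthSliceCoercive C D Q′ Q a c`**: `∀ A, (∀ λ, Q′λ = 0 → ⟨Dλ, A⟩ = 0) → c·nsq A ≤ nsq (CA) + a·nsq (QA)` — coercivity
   of the gauge-INVARIANT form on the ℓ²-orthogonal complement of the residual gauge orbit directions `D(N(Q′))`; under `Q′Q′ᴴ = θ·1`
   the orthogonality is EQUIVALENT to «`DᴴA ∈ range Q′ᴴ`» (block-constant region divergence): `orth_of_div_const`, `div_const_of_orth`.
 * §2 THE EXPLICIT ORTHOGONAL REPRESENTATIVE of a field `A` in its residual orbit: `coarsePart A = (Q′G′Q′ᴴ)⁻¹Q′G′DᴴA`,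
   **`orthGauge A = G′(DᴴA − Q′ᴴ·coarsePart A) ∈ N(Q′)`**, `orthPart A = A − D·orthGauge A ⊥ D(N(Q′))` with
   `Dᴴ(orthPart A) = Q′ᴴ·coarsePart A`, `C(orthPart A) = CA`, `Q(orthPart A) = QA`, and PYTHAGORAS `nsq A = nsq (orthPart A) + nsq (D·orthGauge A)`.
 * §3 THE COMPARISON OF THE TWO SLICES: if `A` lies on Bałaban's slice then (`R` fixes `Δ′N(Q′)`) **`nsq (Δ′μ_A) ≤ nsq f_A`**
   (`μ_A = orthGauge A`, `f_A = Q′ᴴ·coarsePart A`); with the block Poincaré inequality on `N(Q′)` (`nsq μ ≤ C_P·nsq (Dμ)`)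
   **`nsq (Dμ_A) ≤ C_P·nsq f_A`**; and — for every `A` — from `κ·nsq (Q′ᴴφ) ≤ re⟨Q′ᴴφ, G′Q′ᴴφ⟩` (coercivity of `G′` on block constants,
   the tree's (3.48)-shape bound) and `nsq (Dφ) ≤ re⟨φ, Δ′φ⟩`: **`κ·nsq f_A ≤ nsq (orthPart A)`** (an `H⁻¹` duality); hence
   **`nsq A ≤ (1 + C_P/κ)·nsq (orthPart A)`** on Bałaban's slice.
 * §4 THE ENDS **`sliceCoercive_of_orthSlice`**: `OrthSliceCoercive … c ⟹ SliceCoercive … (c/(1 + C_P/κ))`, with the invertibility of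
   `Q′G′Q′ᴴ` supplied from `Q′Q′ᴴ = θ·1` + the `κ`-bound (`isUnit_det_gramS`); and the converse **`orthSlice_of_sliceCoercive`** (same `c`):
   the two displayed inequalities are EQUIVALENT up to the factor `1 + C_P/κ`, uniformly in whatever `C_P`, `κ` are uniform in.  For the
   region instance (`RegionGaugeSliceOrthRegion`): `θ = n^{−d}`, `κ = σ₀(d,a′)`, `C_P = 4d` — all uniform in `n = η⁻¹`, `M` and the block union.

ABSOLUTE RULE (cell, verbatim): «No internally-minted statement may enter as a cited fact. Every hypothesis is either kernel-proved in
this package or a verbatim quotation of a PUBLISHED theorem with page reference. The manuscript(s) under audit are NOT citable for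
their own disputed steps — they are the thing under adjudication; programme-internal (2001/route/tribunal) claims are never citable.»
[folklore] throughout; the only predicates are parametrised hypothesis SHAPES (`OrthSliceCoercive`, leaf-07's `SliceData`/`SliceCoercive`/
`Coercive`); no `def … : Prop` fact.  NOT CLAIMED: the slice inequality for any region `S ≠ ⊤`; NE2; NE3; «not in print; our reduction».
-/

noncomputable section

open scoped BigOperators ComplexConjugate Matrix Matrix.Norms.L2Operator

namespace Summit.QuantumFields.BalabanUV.T4Continuum.RegionGaugeSliceOrth

open Literature.MathematicalPhysics.QuantumFieldTheory.Balaban1983to89.B5Prop11Lower (nsq nsq_nonneg star_dotProduct_self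
  norm_star_dotProduct_le)
open Literature.MathematicalPhysics.QuantumFieldTheory.Balaban1983to89.B5Action121 (star_mulVec_dotProduct
  dotProduct_mulVec_eq_star_conjTranspose_mulVec)
open Summit.QuantumFields.BalabanUV.T4Continuum
open Summit.QuantumFields.BalabanUV.T4Continuum.SubtypeCompression (Coercive isUnit_det_of_coercive eq_zero_of_nsq_eq_zero)
open Summit.QuantumFields.BalabanUV.T4Continuum.ScalarAveragedPropagator (re_star_dotProduct_le)
open Summit.QuantumFields.BalabanUV.T4Continuum.RegionGaugeProjection
open Summit.QuantumFields.BalabanUV.T4Continuum.RegionGaugeSlice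

variable {m v w u uv : Type*} [Fintype m] [Fintype v] [Fintype u]

/-! ## §0 Two `ℓ²` tools -/

/-- PYTHAGORAS: `⟨y, x⟩ = 0 ⟹ nsq (x + y) = nsq x + nsq y`. [folklore] -/
theorem nsq_add_of_orth (x y : v → ℂ) (h : star y ⬝ᵥ x = 0) : nsq (x + y) = nsq x + nsq y := by
  have h' : star x ⬝ᵥ y = 0 := by rw [Matrix.star_dotProduct, h, star_zero]
  have e : ((nsq (x + y) : ℝ) : ℂ) = ((nsq x : ℝ) : ℂ) + ((nsq y : ℝ) : ℂ) := by
    rw [← star_dotProduct_self, ← star_dotProduct_self, ← star_dotProduct_self, star_add, add_dotProduct, dotProduct_add,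
      dotProduct_add, h, h', add_zero, zero_add]
  exact_mod_cast e

/-- absorption: `X ≤ √X·√Y ⟹ X ≤ Y` for `0 ≤ X, Y` (from `√X√Y ≤ (X+Y)/2`). [folklore] -/
theorem le_of_le_sqrt_mul_sqrt {X Y : ℝ} (hX : 0 ≤ X) (hY : 0 ≤ Y) (h : X ≤ Real.sqrt X * Real.sqrt Y) : X ≤ Y := by
  nlinarith [sq_nonneg (Real.sqrt X - Real.sqrt Y), Real.sq_sqrt hX, Real.sq_sqrt hY]

/-! ## §1 The orthogonal slice and its kernel characterisation -/

/-- [shape] **COERCIVITY OF THE GAUGE-INVARIANT FORM ON THE ORTHOGONAL SLICE** (parametric predicate, like `SliceCoercive`): every field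
`A` that is ℓ²-orthogonal to the residual gauge directions `Dλ`, `λ ∈ N(Q′)`, obeys `c·nsq A ≤ nsq (CA) + a·nsq (QA)`.  Displayed, not
proved. [folklore] -/
def OrthSliceCoercive [Fintype w] [Fintype uv] (Cu : Matrix w v ℂ) (Dg : Matrix v m ℂ) (Qs : Matrix u m ℂ) (Qv : Matrix uv v ℂ)
    (a c : ℝ) : Prop :=
  ∀ A : v → ℂ, (∀ lam : m → ℂ, Qs *ᵥ lam = 0 → star (Dg *ᵥ lam) ⬝ᵥ A = 0) → c * nsq A ≤ nsq (Cu *ᵥ A) + a * nsq (Qv *ᵥ A)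

variable (Dg : Matrix v m ℂ) (Dp G : Matrix m m ℂ) (Qs : Matrix u m ℂ)

/-- a field with BLOCK-CONSTANT divergence (`DᴴA = Q′ᴴc`) is orthogonal to the residual gauge directions. [folklore] -/
theorem orth_of_div_const (A : v → ℂ) {cc : u → ℂ} (hA : Dgᴴ *ᵥ A = Qsᴴ *ᵥ cc) (lam : m → ℂ) (hlam : Qs *ᵥ lam = 0) :
    star (Dg *ᵥ lam) ⬝ᵥ A = 0 := by
  rw [star_mulVec_dotProduct, hA, dotProduct_mulVec_eq_star_conjTranspose_mulVec, Matrix.conjTranspose_conjTranspose, hlam,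
    star_zero, zero_dotProduct]

/-- under `Q′Q′ᴴ = θ·1` (`θ ≠ 0`): a scalar `x` orthogonal to `N(Q′)` is block-constant, `x = Q′ᴴ(θ⁻¹·Q′x)`. [folklore] -/
theorem eq_QH_of_orth_ker [DecidableEq u] {θ : ℝ} (hQQ : Qs * Qsᴴ = (θ : ℂ) • (1 : Matrix u u ℂ)) (hθ : θ ≠ 0) (x : m → ℂ)
    (hx : ∀ lam : m → ℂ, Qs *ᵥ lam = 0 → star lam ⬝ᵥ x = 0) :
    x = Qsᴴ *ᵥ (((θ : ℂ)⁻¹) • (Qs *ᵥ x)) := by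
  have hθc : (θ : ℂ) ≠ 0 := by exact_mod_cast hθ
  have hQQv : ∀ w : u → ℂ, Qs *ᵥ (Qsᴴ *ᵥ w) = (θ : ℂ) • w := fun w => by
    rw [Matrix.mulVec_mulVec, hQQ, Matrix.smul_mulVec, Matrix.one_mulVec]
  obtain ⟨g, hg⟩ : ∃ g, g = x - Qsᴴ *ᵥ (((θ : ℂ)⁻¹) • (Qs *ᵥ x)) := ⟨_, rfl⟩
  -- `g ∈ N(Q′)`
  have hQg : Qs *ᵥ g = 0 := by
    rw [hg, Matrix.mulVec_sub, hQQv, smul_smul, mul_inv_cancel₀ hθc, one_smul, sub_self]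
  -- `⟨g, x⟩ = 0` and `⟨g, Q′ᴴ·⟩ = ⟨Q′g, ·⟩ = 0`, so `⟨g, g⟩ = 0`
  have h1 : star g ⬝ᵥ x = 0 := hx g hQg
  have h2 : star g ⬝ᵥ (Qsᴴ *ᵥ (((θ : ℂ)⁻¹) • (Qs *ᵥ x))) = 0 := by
    rw [dotProduct_mulVec_eq_star_conjTranspose_mulVec, Matrix.conjTranspose_conjTranspose, hQg, star_zero, zero_dotProduct]
  have h3 : star g ⬝ᵥ g = 0 := by
    have e : star g ⬝ᵥ (x - Qsᴴ *ᵥ (((θ : ℂ)⁻¹) • (Qs *ᵥ x))) = 0 := by rw [dotProduct_sub, h1, h2, sub_zero]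
    rwa [← hg] at e
  have h4 : nsq g = 0 := by
    have e := star_dotProduct_self g
    rw [h3] at e
    exact_mod_cast e.symm
  have h5 : g = 0 := eq_zero_of_nsq_eq_zero h4
  rw [hg, sub_eq_zero] at h5
  exact h5

/-- conversely, under `Q′Q′ᴴ = θ·1` (`θ ≠ 0`): orthogonality to the residual gauge directions forces `DᴴA = Q′ᴴ(θ⁻¹·Q′DᴴA)` —
the region divergence IS block-constant. [folklore] -/
theorem div_const_of_orth [DecidableEq u] {θ : ℝ} (hQQ : Qs * Qsᴴ = (θ : ℂ) • (1 : Matrix u u ℂ)) (hθ : θ ≠ 0) (A : v → ℂ)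
    (hA : ∀ lam : m → ℂ, Qs *ᵥ lam = 0 → star (Dg *ᵥ lam) ⬝ᵥ A = 0) :
    Dgᴴ *ᵥ A = Qsᴴ *ᵥ (((θ : ℂ)⁻¹) • (Qs *ᵥ (Dgᴴ *ᵥ A))) := by
  refine eq_QH_of_orth_ker Qs hQQ hθ _ fun lam hlam => ?_
  rw [dotProduct_mulVec_eq_star_conjTranspose_mulVec, Matrix.conjTranspose_conjTranspose]
  exact hA lam hlam

/-! ## §2 The explicit orthogonal representative -/

/-- `Q′G′Q′ᴴ` (Bałaban's `Q′G′Q′*` up to the weight `n^d`). [cite: Balaban1985BackgroundPropagators, (3.25) p.394 (shape)] [folklore] -/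
def gramS : Matrix u u ℂ := Qs * G * Qsᴴ

/-- the COARSE PART `c_A = (Q′G′Q′ᴴ)⁻¹·Q′G′DᴴA` (block data of the divergence). [folklore] -/
def coarsePart [DecidableEq u] (A : v → ℂ) : u → ℂ := (gramS G Qs)⁻¹ *ᵥ (Qs *ᵥ (G *ᵥ (Dgᴴ *ᵥ A)))

/-- the ORTHOGONAL GAUGE `μ_A = G′(DᴴA − Q′ᴴc_A)`. [folklore] -/
def orthGauge [DecidableEq u] (A : v → ℂ) : m → ℂ := G *ᵥ (Dgᴴ *ᵥ A - Qsᴴ *ᵥ coarsePart Dg G Qs A)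

/-- the ORTHOGONAL REPRESENTATIVE `A^⊥ = A − D·μ_A` of the residual orbit of `A`. [folklore] -/
def orthPart [DecidableEq u] (A : v → ℂ) : v → ℂ := A - Dg *ᵥ orthGauge Dg G Qs A

variable {Cu : Matrix w v ℂ} {Dg Dp G Qs} {Qv : Matrix uv v ℂ} {Dg₁ : Matrix uv u ℂ}
variable [DecidableEq m] [DecidableEq u]

omit [DecidableEq m] in
/-- `Q′·G′·Q′ᴴ·c_A = Q′G′DᴴA` (the defining equation of the coarse part). [folklore] -/
theorem gramS_coarsePart (hS : IsUnit (gramS G Qs).det) (A : v → ℂ) :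
    Qs *ᵥ (G *ᵥ (Qsᴴ *ᵥ coarsePart Dg G Qs A)) = Qs *ᵥ (G *ᵥ (Dgᴴ *ᵥ A)) := by
  have e : ∀ y : u → ℂ, Qs *ᵥ (G *ᵥ (Qsᴴ *ᵥ ((gramS G Qs)⁻¹ *ᵥ y))) = y := fun y => by
    rw [Matrix.mulVec_mulVec, Matrix.mulVec_mulVec, Matrix.mulVec_mulVec]
    change (gramS G Qs * (gramS G Qs)⁻¹) *ᵥ y = y
    rw [Matrix.mul_nonsing_inv _ hS, Matrix.one_mulVec]
  exact e _

omit [DecidableEq m] in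
/-- **`μ_A ∈ N(Q′)`**: `Q′μ_A = 0`. [folklore] -/
theorem Qs_orthGauge (hS : IsUnit (gramS G Qs).det) (A : v → ℂ) : Qs *ᵥ orthGauge Dg G Qs A = 0 := by
  rw [orthGauge, Matrix.mulVec_sub, Matrix.mulVec_sub, gramS_coarsePart hS A, sub_self]

/-- **THE DIVERGENCE OF `A^⊥` IS BLOCK-CONSTANT**: `DᴴA^⊥ = Q′ᴴc_A`. [folklore] -/
theorem Dh_orthPart (h : SliceData Cu Dg Dp G Qs Qv Dg₁) (hS : IsUnit (gramS G Qs).det) (A : v → ℂ) :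
    Dgᴴ *ᵥ orthPart Dg G Qs A = Qsᴴ *ᵥ coarsePart Dg G Qs A := by
  rw [orthPart, Matrix.mulVec_sub, ← h.lap_of_ker _ (Qs_orthGauge hS A), orthGauge, Matrix.mulVec_mulVec, h.mul_G,
    Matrix.one_mulVec, sub_sub_cancel]

/-- `DᴴA = Δ′μ_A + Q′ᴴc_A`. [folklore] -/
theorem Dh_eq_Dp_orthGauge_add (h : SliceData Cu Dg Dp G Qs Qv Dg₁) (hS : IsUnit (gramS G Qs).det) (A : v → ℂ) :
    Dgᴴ *ᵥ A = Dp *ᵥ orthGauge Dg G Qs A + Qsᴴ *ᵥ coarsePart Dg G Qs A := by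
  have e := Dh_orthPart h hS A
  rw [orthPart, Matrix.mulVec_sub, ← h.lap_of_ker _ (Qs_orthGauge hS A), sub_eq_iff_eq_add'] at e
  rw [e, add_comm]

/-- **`A^⊥ ⊥ D(N(Q′))`**. [folklore] -/
theorem orth_orthPart (h : SliceData Cu Dg Dp G Qs Qv Dg₁) (hS : IsUnit (gramS G Qs).det) (A : v → ℂ) (lam : m → ℂ)
    (hlam : Qs *ᵥ lam = 0) : star (Dg *ᵥ lam) ⬝ᵥ orthPart Dg G Qs A = 0 :=
  orth_of_div_const Dg Qs _ (Dh_orthPart h hS A) lam hlam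

/-- `C A^⊥ = C A` (pure gauges are curl-free). [folklore] -/
theorem Cu_orthPart [Fintype w] (h : SliceData Cu Dg Dp G Qs Qv Dg₁) (A : v → ℂ) : Cu *ᵥ orthPart Dg G Qs A = Cu *ᵥ A := by
  rw [orthPart, Matrix.mulVec_sub, Matrix.mulVec_mulVec, h.curl_grad, Matrix.zero_mulVec, sub_zero]

/-- `Q A^⊥ = Q A` (`QDμ = D₁Q′μ = 0` for `μ ∈ N(Q′)`). [folklore] -/
theorem Qv_orthPart [Fintype uv] (h : SliceData Cu Dg Dp G Qs Qv Dg₁) (hS : IsUnit (gramS G Qs).det) (A : v → ℂ) :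
    Qv *ᵥ orthPart Dg G Qs A = Qv *ᵥ A := by
  rw [orthPart, Matrix.mulVec_sub, Matrix.mulVec_mulVec, h.avg_grad, ← Matrix.mulVec_mulVec, Qs_orthGauge hS A,
    Matrix.mulVec_zero, sub_zero]

omit [DecidableEq m] in
/-- `A = A^⊥ + Dμ_A`. [folklore] -/
theorem orthPart_add (A : v → ℂ) : orthPart Dg G Qs A + Dg *ᵥ orthGauge Dg G Qs A = A := by
  rw [orthPart, sub_add_cancel]

/-- **PYTHAGORAS**: `nsq A = nsq A^⊥ + nsq (Dμ_A)`. [folklore] -/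
theorem nsq_eq_orthPart_add (h : SliceData Cu Dg Dp G Qs Qv Dg₁) (hS : IsUnit (gramS G Qs).det) (A : v → ℂ) :
    nsq A = nsq (orthPart Dg G Qs A) + nsq (Dg *ᵥ orthGauge Dg G Qs A) := by
  conv_lhs => rw [← orthPart_add (Dg := Dg) (G := G) (Qs := Qs) A]
  exact nsq_add_of_orth _ _ (orth_orthPart h hS A _ (Qs_orthGauge hS A))

/-- hence `nsq A^⊥ ≤ nsq A`: the orthogonal representative is the SMALLEST point of the residual orbit. [folklore] -/
theorem nsq_orthPart_le (h : SliceData Cu Dg Dp G Qs Qv Dg₁) (hS : IsUnit (gramS G Qs).det) (A : v → ℂ) :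
    nsq (orthPart Dg G Qs A) ≤ nsq A := by
  rw [nsq_eq_orthPart_add h hS A]
  have := nsq_nonneg (Dg *ᵥ orthGauge Dg G Qs A)
  linarith

/-! ## §3 The comparison of Bałaban's slice with the orthogonal slice -/

/-- **ON BAŁABAN's SLICE THE LAPLACIAN OF THE ORTHOGONAL GAUGE IS DOMINATED BY THE BLOCK-CONSTANT PART OF THE DIVERGENCE**:
`R·DᴴA = 0 ⟹ nsq (Δ′μ_A) ≤ nsq (Q′ᴴc_A)` (since `R` fixes `Δ′μ_A ∈ Δ′N(Q′)` and kills `DᴴA = Δ′μ_A + Q′ᴴc_A`).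
[cite: Balaban1985BackgroundPropagators, (3.21) p.394 (shape: R projects onto Δ′N(Q′))] [folklore] -/
theorem nsq_Dp_orthGauge_le (h : SliceData Cu Dg Dp G Qs Qv Dg₁) (hS : IsUnit (gramS G Qs).det) (A : v → ℂ)
    (hR : gaugeR G Qs *ᵥ (Dgᴴ *ᵥ A) = 0) :
    nsq (Dp *ᵥ orthGauge Dg G Qs A) ≤ nsq (Qsᴴ *ᵥ coarsePart Dg G Qs A) := by
  set y := Dp *ᵥ orthGauge Dg G Qs A with hy
  set f := Qsᴴ *ᵥ coarsePart Dg G Qs A with hf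
  -- `R y = y`
  have hRy : gaugeR G Qs *ᵥ y = y := gaugeR_mulVec_D_mulVec G Qs h.G_mul _ (Qs_orthGauge hS A)
  -- `⟨y, DᴴA⟩ = ⟨Ry, DᴴA⟩ = ⟨y, R·DᴴA⟩ = 0`
  have h0 : star y ⬝ᵥ (Dgᴴ *ᵥ A) = 0 := by
    rw [← hRy, star_mulVec_dotProduct, (gaugeR_isHermitian G Qs h.herm).eq, hR, dotProduct_zero]
  rw [Dh_eq_Dp_orthGauge_add h hS A, ← hy, ← hf, dotProduct_add, star_dotProduct_self] at h0
  -- so `nsq y = −re⟨y, f⟩ ≤ √(nsq y)·√(nsq f)`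
  have h1 : nsq y = -(star y ⬝ᵥ f).re := by
    have := congrArg Complex.re h0
    rw [Complex.add_re, Complex.ofReal_re, Complex.zero_re] at this
    linarith
  have h2 : nsq y ≤ Real.sqrt (nsq y) * Real.sqrt (nsq f) := by
    calc nsq y = -(star y ⬝ᵥ f).re := h1
      _ = (-(star y ⬝ᵥ f)).re := by rw [Complex.neg_re]
      _ ≤ ‖-(star y ⬝ᵥ f)‖ := Complex.re_le_norm _
      _ = ‖star y ⬝ᵥ f‖ := norm_neg _
      _ ≤ Real.sqrt (nsq y) * Real.sqrt (nsq f) := norm_star_dotProduct_le y f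
  exact le_of_le_sqrt_mul_sqrt (nsq_nonneg _) (nsq_nonneg _) h2

/-- **WITH THE BLOCK POINCARÉ INEQUALITY ON `N(Q′)`** (`nsq μ ≤ C_P·nsq (Dμ)` for `Q′μ = 0`): on Bałaban's slice
`nsq (Dμ_A) ≤ C_P·nsq (Q′ᴴc_A)` (from `nsq (Dμ) = re⟨μ, Δ′μ⟩ ≤ √(nsq μ)√(nsq (Δ′μ))`). [folklore] -/
theorem nsq_Dg_orthGauge_le (h : SliceData Cu Dg Dp G Qs Qv Dg₁) (hS : IsUnit (gramS G Qs).det) {C_P : ℝ} (hCP : 0 ≤ C_P)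
    (hP : ∀ mu : m → ℂ, Qs *ᵥ mu = 0 → nsq mu ≤ C_P * nsq (Dg *ᵥ mu)) (A : v → ℂ) (hR : gaugeR G Qs *ᵥ (Dgᴴ *ᵥ A) = 0) :
    nsq (Dg *ᵥ orthGauge Dg G Qs A) ≤ C_P * nsq (Qsᴴ *ᵥ coarsePart Dg G Qs A) := by
  set mu := orthGauge Dg G Qs A with hmu
  set X := nsq (Dg *ᵥ mu) with hX
  set F := nsq (Qsᴴ *ᵥ coarsePart Dg G Qs A) with hF
  have hmu0 : Qs *ᵥ mu = 0 := Qs_orthGauge hS A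
  -- `X = re⟨μ, Δ′μ⟩`
  have e1 : X = (star mu ⬝ᵥ (Dp *ᵥ mu)).re := by
    rw [hX, h.lap_of_ker mu hmu0, dotProduct_mulVec_eq_star_conjTranspose_mulVec, Matrix.conjTranspose_conjTranspose,
      star_dotProduct_self, Complex.ofReal_re]
  have e2 : X ≤ Real.sqrt (nsq mu) * Real.sqrt (nsq (Dp *ᵥ mu)) := by rw [e1]; exact re_star_dotProduct_le _ _
  have e3 : Real.sqrt (nsq mu) ≤ Real.sqrt (C_P * X) := Real.sqrt_le_sqrt (hP mu hmu0)
  have e4 : Real.sqrt (nsq (Dp *ᵥ mu)) ≤ Real.sqrt F := Real.sqrt_le_sqrt (nsq_Dp_orthGauge_le h hS A hR)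
  have hX0 : 0 ≤ X := nsq_nonneg _
  have hF0 : 0 ≤ F := nsq_nonneg _
  have e5 : X ≤ Real.sqrt (C_P * X) * Real.sqrt F :=
    e2.trans (mul_le_mul e3 e4 (Real.sqrt_nonneg _) (Real.sqrt_nonneg _))
  -- `√(C_P X)·√F ≤ (X + C_P F)/2`
  have e6 : Real.sqrt (C_P * X) * Real.sqrt F ≤ (X + C_P * F) / 2 := by
    have e7 : Real.sqrt (C_P * X) * Real.sqrt F = Real.sqrt X * Real.sqrt (C_P * F) := by
      rw [← Real.sqrt_mul (by positivity), ← Real.sqrt_mul hX0]; ring_nf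
    rw [e7]
    nlinarith [sq_nonneg (Real.sqrt X - Real.sqrt (C_P * F)), Real.sq_sqrt hX0, Real.sq_sqrt (show 0 ≤ C_P * F by positivity)]
  linarith

/-- **THE BLOCK-CONSTANT PART OF THE DIVERGENCE IS PAID BY THE ORTHOGONAL REPRESENTATIVE** (every `A`, no slice hypothesis): if `G′` is
`κ`-coercive on block constants (`κ·nsq (Q′ᴴφ) ≤ re⟨Q′ᴴφ, G′Q′ᴴφ⟩`, the (3.48)-shape bound) and `nsq (Dφ) ≤ re⟨φ, Δ′φ⟩`, then
`κ·nsq (Q′ᴴc_A) ≤ nsq A^⊥` (`H⁻¹` duality: `re⟨f, G′f⟩ = re⟨A^⊥, DG′f⟩ ≤ √(nsq A^⊥)·√(re⟨f, G′f⟩)`).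
[cite: Balaban1985BackgroundPropagators, p.395 (positivity of G′) (shape)] [folklore] -/
theorem nsq_const_le_orthPart (h : SliceData Cu Dg Dp G Qs Qv Dg₁) (hS : IsUnit (gramS G Qs).det) {κ : ℝ}
    (hκ : ∀ φ : u → ℂ, κ * nsq (Qsᴴ *ᵥ φ) ≤ (star (Qsᴴ *ᵥ φ) ⬝ᵥ (G *ᵥ (Qsᴴ *ᵥ φ))).re)
    (hL : ∀ φ : m → ℂ, nsq (Dg *ᵥ φ) ≤ (star φ ⬝ᵥ (Dp *ᵥ φ)).re) (A : v → ℂ) :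
    κ * nsq (Qsᴴ *ᵥ coarsePart Dg G Qs A) ≤ nsq (orthPart Dg G Qs A) := by
  set f := Qsᴴ *ᵥ coarsePart Dg G Qs A with hf
  set B := orthPart Dg G Qs A with hB
  set X := (star f ⬝ᵥ (G *ᵥ f)).re with hX
  -- (i) `κ·nsq f ≤ X`
  have h1 : κ * nsq f ≤ X := hκ _
  -- (iii) `nsq (DG′f) ≤ re⟨G′f, Δ′G′f⟩ = re⟨G′f, f⟩ = X`
  have h3 : nsq (Dg *ᵥ (G *ᵥ f)) ≤ X := by
    have e0 : Dp *ᵥ (G *ᵥ f) = f := by rw [Matrix.mulVec_mulVec, h.mul_G, Matrix.one_mulVec]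
    have e := hL (G *ᵥ f)
    rw [e0, star_mulVec_dotProduct, h.herm.eq] at e
    exact e
  have hX0 : 0 ≤ X := (nsq_nonneg _).trans h3
  -- (ii) `X = re⟨DᴴA^⊥, G′f⟩ = re⟨A^⊥, DG′f⟩ ≤ √(nsq A^⊥)·√(nsq (DG′f))`
  have h2 : X ≤ Real.sqrt (nsq B) * Real.sqrt X := by
    have e : star f ⬝ᵥ (G *ᵥ f) = star B ⬝ᵥ (Dg *ᵥ (G *ᵥ f)) := by
      rw [hf, ← Dh_orthPart h hS A, star_mulVec_dotProduct, Matrix.conjTranspose_conjTranspose]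
    calc X = (star B ⬝ᵥ (Dg *ᵥ (G *ᵥ f))).re := by rw [hX, e]
      _ ≤ Real.sqrt (nsq B) * Real.sqrt (nsq (Dg *ᵥ (G *ᵥ f))) := re_star_dotProduct_le _ _
      _ ≤ Real.sqrt (nsq B) * Real.sqrt X := mul_le_mul_of_nonneg_left (Real.sqrt_le_sqrt h3) (Real.sqrt_nonneg _)
  -- (iv) absorb
  have h4 : X ≤ nsq B := by
    have := le_of_le_sqrt_mul_sqrt hX0 (nsq_nonneg B) (by rw [mul_comm] at h2; exact h2)
    exact this
  exact h1.trans h4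

/-- **THE COMPARISON**: on Bałaban's slice `nsq A ≤ (1 + C_P/κ)·nsq A^⊥` — the slice representative is at most `√(1 + C_P/κ)` times
the smallest point of its residual orbit. [folklore] -/
theorem nsq_le_orthPart (h : SliceData Cu Dg Dp G Qs Qv Dg₁) (hS : IsUnit (gramS G Qs).det) {C_P κ : ℝ} (hCP : 0 ≤ C_P)
    (hκ0 : 0 < κ) (hP : ∀ mu : m → ℂ, Qs *ᵥ mu = 0 → nsq mu ≤ C_P * nsq (Dg *ᵥ mu))
    (hκ : ∀ φ : u → ℂ, κ * nsq (Qsᴴ *ᵥ φ) ≤ (star (Qsᴴ *ᵥ φ) ⬝ᵥ (G *ᵥ (Qsᴴ *ᵥ φ))).re)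
    (hL : ∀ φ : m → ℂ, nsq (Dg *ᵥ φ) ≤ (star φ ⬝ᵥ (Dp *ᵥ φ)).re) (A : v → ℂ) (hR : gaugeR G Qs *ᵥ (Dgᴴ *ᵥ A) = 0) :
    nsq A ≤ (1 + C_P / κ) * nsq (orthPart Dg G Qs A) := by
  have e0 := nsq_eq_orthPart_add h hS A
  have e1 := nsq_Dg_orthGauge_le h hS hCP hP A hR
  have e2 := nsq_const_le_orthPart h hS hκ hL A
  set F := nsq (Qsᴴ *ᵥ coarsePart Dg G Qs A)
  set B := nsq (orthPart Dg G Qs A)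
  have e3 : F ≤ B / κ := by rw [le_div_iff₀ hκ0, mul_comm]; exact e2
  have e4 : C_P * F ≤ C_P / κ * B := by
    calc C_P * F ≤ C_P * (B / κ) := mul_le_mul_of_nonneg_left e3 hCP
      _ = C_P / κ * B := by ring
  calc nsq A = B + nsq (Dg *ᵥ orthGauge Dg G Qs A) := e0
    _ ≤ B + C_P * F := by linarith
    _ ≤ B + C_P / κ * B := by linarith
    _ = (1 + C_P / κ) * B := by ring

/-! ## §4 The ENDs: the two slices are equivalent -/

omit [DecidableEq m] in
/-- `Q′G′Q′ᴴ` is COERCIVE (hence invertible) from `Q′Q′ᴴ = θ·1` and the `κ`-bound: `(κθ)·nsq φ ≤ re⟨φ, Q′G′Q′ᴴφ⟩`. [folklore] -/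
theorem coercive_gramS {θ κ : ℝ} (hQQ : Qs * Qsᴴ = (θ : ℂ) • (1 : Matrix u u ℂ))
    (hκ : ∀ φ : u → ℂ, κ * nsq (Qsᴴ *ᵥ φ) ≤ (star (Qsᴴ *ᵥ φ) ⬝ᵥ (G *ᵥ (Qsᴴ *ᵥ φ))).re) :
    Coercive (gramS G Qs) (κ * θ) := by
  intro φ
  have e : star φ ⬝ᵥ (gramS G Qs *ᵥ φ) = star (Qsᴴ *ᵥ φ) ⬝ᵥ (G *ᵥ (Qsᴴ *ᵥ φ)) := by
    rw [gramS, ← Matrix.mulVec_mulVec, ← Matrix.mulVec_mulVec, dotProduct_mulVec_eq_star_conjTranspose_mulVec]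
  rw [e]
  have h1 := hκ φ
  rw [nsq_QH_mulVec Qs hQQ, ← mul_assoc] at h1
  exact h1

omit [DecidableEq m] in
/-- hence `Q′G′Q′ᴴ` is invertible when `κ, θ > 0`. [cite: Balaban1985BackgroundPropagators, p.395 (existence) (shape)] [folklore] -/
theorem isUnit_det_gramS {θ κ : ℝ} (hQQ : Qs * Qsᴴ = (θ : ℂ) • (1 : Matrix u u ℂ)) (hθ : 0 < θ) (hκ0 : 0 < κ)
    (hκ : ∀ φ : u → ℂ, κ * nsq (Qsᴴ *ᵥ φ) ≤ (star (Qsᴴ *ᵥ φ) ⬝ᵥ (G *ᵥ (Qsᴴ *ᵥ φ))).re) :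
    IsUnit (gramS G Qs).det :=
  isUnit_det_of_coercive (mul_pos hκ0 hθ) (coercive_gramS hQQ hκ)

/-- **THE REDUCTION (⇐)**: coercivity on the orthogonal slice with constant `c ≥ 0` ⟹ coercivity on Bałaban's slice with constant
`c/(1 + C_P/κ)`, given: the structural identities `SliceData`, `Q′Q′ᴴ = θ·1` (`θ > 0`), the block Poincaré inequality on `N(Q′)`
(`C_P ≥ 0`), the `κ`-coercivity of `G′` on block constants (`κ > 0`) and `DᴴD ≤ Δ′` as forms.
[cite: Balaban1985BackgroundPropagators, (3.21)/(3.25)–(3.27) pp.394–395 (shapes)] [folklore] -/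
theorem sliceCoercive_of_orthSlice [Fintype w] [Fintype uv] (h : SliceData Cu Dg Dp G Qs Qv Dg₁) {θ C_P κ a c : ℝ}
    (hQQ : Qs * Qsᴴ = (θ : ℂ) • (1 : Matrix u u ℂ)) (hθ : 0 < θ) (hCP : 0 ≤ C_P) (hκ0 : 0 < κ) (hc : 0 ≤ c)
    (hP : ∀ mu : m → ℂ, Qs *ᵥ mu = 0 → nsq mu ≤ C_P * nsq (Dg *ᵥ mu))
    (hκ : ∀ φ : u → ℂ, κ * nsq (Qsᴴ *ᵥ φ) ≤ (star (Qsᴴ *ᵥ φ) ⬝ᵥ (G *ᵥ (Qsᴴ *ᵥ φ))).re)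
    (hL : ∀ φ : m → ℂ, nsq (Dg *ᵥ φ) ≤ (star φ ⬝ᵥ (Dp *ᵥ φ)).re) (hO : OrthSliceCoercive Cu Dg Qs Qv a c) :
    SliceCoercive Cu Dg G Qs Qv a (c / (1 + C_P / κ)) := by
  intro A hR
  have hS := isUnit_det_gramS hQQ hθ hκ0 hκ
  have hr : 0 < 1 + C_P / κ := by positivity
  have key := hO (orthPart Dg G Qs A) (orth_orthPart h hS A)
  rw [Cu_orthPart h A, Qv_orthPart h hS A] at key
  have cmp := nsq_le_orthPart h hS hCP hκ0 hP hκ hL A hR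
  calc c / (1 + C_P / κ) * nsq A ≤ c / (1 + C_P / κ) * ((1 + C_P / κ) * nsq (orthPart Dg G Qs A)) :=
        mul_le_mul_of_nonneg_left cmp (div_nonneg hc hr.le)
    _ = c * nsq (orthPart Dg G Qs A) := by field_simp
    _ ≤ nsq (Cu *ᵥ A) + a * nsq (Qv *ᵥ A) := key

/-- **THE REDUCTION (⇒)**: coercivity on Bałaban's slice with `c ≥ 0` ⟹ coercivity on the orthogonal slice with the SAME `c` (leaf-07's
decomposition `A = Dλ_A + A′`: for `A ⊥ D(N(Q′))`, `nsq A ≤ nsq A′` by Pythagoras, and `CA′ = CA`, `QA′ = QA`). [folklore] -/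
theorem orthSlice_of_sliceCoercive [Fintype w] [Fintype uv] (h : SliceData Cu Dg Dp G Qs Qv Dg₁) {a c : ℝ} (hc : 0 ≤ c)
    (hS : SliceCoercive Cu Dg G Qs Qv a c) : OrthSliceCoercive Cu Dg Qs Qv a c := by
  intro A hA
  set A' := slicePart Dg G Qs A with hA'
  have key := hS A' (gaugeR_Dh_slicePart h A)
  rw [Cu_slicePart h A, Qv_slicePart h A] at key
  -- `A′ = A + D(−λ_A)` with `⟨D(−λ_A), A⟩ = 0`
  have e : A' = A + Dg *ᵥ (-gaugePart Dg G Qs A) := by rw [hA', slicePart, Matrix.mulVec_neg, sub_eq_add_neg]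
  have horth : star (Dg *ᵥ (-gaugePart Dg G Qs A)) ⬝ᵥ A = 0 :=
    hA _ (by rw [Matrix.mulVec_neg, Qs_gaugePart h A, neg_zero])
  have hle : nsq A ≤ nsq A' := by
    rw [e, nsq_add_of_orth _ _ horth]
    have := nsq_nonneg (Dg *ᵥ (-gaugePart Dg G Qs A))
    linarith
  exact (mul_le_mul_of_nonneg_left hle hc).trans key

omit [DecidableEq m] in
/-- and on the orthogonal slice the field may be TESTED against block-constant divergences only: `OrthSliceCoercive` ⟺ «every `A` with
`DᴴA = Q′ᴴcc` obeys the inequality» (under `Q′Q′ᴴ = θ·1`, `θ ≠ 0`). [folklore] -/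
theorem orthSlice_iff_div_const [Fintype w] [Fintype uv] {θ : ℝ} (hQQ : Qs * Qsᴴ = (θ : ℂ) • (1 : Matrix u u ℂ)) (hθ : θ ≠ 0)
    (a c : ℝ) :
    OrthSliceCoercive Cu Dg Qs Qv a c
      ↔ ∀ (A : v → ℂ) (cc : u → ℂ), Dgᴴ *ᵥ A = Qsᴴ *ᵥ cc → c * nsq A ≤ nsq (Cu *ᵥ A) + a * nsq (Qv *ᵥ A) := by
  constructor
  · intro hO A cc hA
    exact hO A (orth_of_div_const Dg Qs A hA)
  · intro hD A hA
    exact hD A _ (div_const_of_orth Dg Qs hQQ hθ A hA)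

end Summit.QuantumFields.BalabanUV.T4Continuum.RegionGaugeSliceOrth

end
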